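/-
Copyright (c) 2026 the pub-hodgecm-mathlib formalisation cell (harness21).  Prover seat hodgecm-mathlib-F0P3a-p01 (g39), lane A (Unr-K, type U) of the (β₂) road, squad
F0∕P3a ∕ F0∕P3c∕LH4; β₂ WORD #42 leaf ‹LINE-L-A-RAY› — the lower-line RAY-band cell worker ON THE HYPERBOLIC TOWER, the lane-A twin of LH7-p09 (g3)'s ★
`…Beta2ConesOffRowLowerWorker.cellDiff_lowerLine_eq_zero_of_le` (as this seat's ★ p865067 W3-A twins LH4-p19 (g3)'s ★ W3), 2026-09-05.
-/
import Summits.HodgeConjecture.HodgeConjecture.Theorems.F0P3cDyRamBeta2ConesOffRowLowerWorker            -- ★ (LH7-p09 (g3)): the lane-B lower worker `cellDiff_lowerLine_eq_zero_of_le`; brings ALL lower-line pieces (★ p863399, ★ p864441, ★ p864666, R0, R1b-A, F1, ★ p863983, …)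
import Summits.HodgeConjecture.HodgeConjecture.Theorems.F0P3cDyRamLowerLineCellLiteralReadsRay           -- ★ p865203 (this seat, L3): `reads_of_gen6_lowerLine_ray` (datum-free R2b-B)
import Summits.HodgeConjecture.HodgeConjecture.Theorems.F0P3cDyRamLowerLineCellLettersAnyRadius          -- (LH4-p06 (g10), L2): `exists_cellLetters_lowerLine_of_radius` (W2-lower at any radius)
import Summits.HodgeConjecture.HodgeConjecture.Theorems.F0P3cDyRamLowerLineSizeLettersRayA              -- (this seat, L1): `lowerLine_sizeLetters_of_ray_A` (datum-free sizes on the RAY band)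
import Summits.HodgeConjecture.HodgeConjecture.Theorems.F0P3cDyRamUnrKThetaFixedRefPair                 -- ★ p864994 (this seat): road (I) `exists_theta_refPair_of_typeU`
import Summits.HodgeConjecture.HodgeConjecture.Theorems.F0P3cDyRamRowCellSocketFibreTypeU               -- ★ p865033 (this seat): (hF) on type U `fibre_ncard_eq_of_lit_of_gen_typeU`; brings ★ p864540 `fgap_of_fixE`
import Summits.HodgeConjecture.HodgeConjecture.Theorems.F0P3cDyRamConeCellEmptyAtlas                    -- ★ p861798 (LH7-p10 (g0)) §3: the Unr-K atlas `levelSet_unrK_hyper_eq_empty_of_lt/_of_odd`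
import HarnessLib

/-!
# Crux `H413`, line LH4 «(D-RAM) FOUR-FRAME» — STAGE-1b, row (2), the (β₂) road (R-36), (OFF) residue, LANE A (Unr-K): «THE LOWER-LINE RAY CELL WORKER ON THE HYPERBOLIC
# TOWER» — `cellDiff_lowerLine_ray_eq_zero_of_hyper_A (N) (hN)` : ‹LINE-L-A-RAY.letter.v1›'s body VERBATIM under the extra premise «the frame `h` of the literal is hyperbolic:
# `∃ x ≠ 0, h·Θx·x + ρ(h·Θx·x) = 0`»; on a cell `(j, b)` of the lower line (`j + b + ℓ₀ = jl`, `2b + ℓ₀ < m`, `b < j`) of the RAY band `m⋆ ≤ b + ℓ₀` the weighted (β₂) labelled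
# difference of the (OFF) residue vanishes: `Σ_{Λ : shell m⋆, VS = VS(X₊)} f − Σ_{Λ : shell m_c, VS ≠ VS(X₊)} f = 0`

Cell `hodgecm-mathlib` (D-0151), FLOOR 0, crux item H413 = `stmt-HodgeConjecture-24833`, route of record `HCCMUnconditional`; squads F0∕P3a ∕ F0∕P3c∕LH4 ∕ LH7; lane
`--supports stmt-HodgeConjecture-24833 --as helper` (count-neutral; pays NO tier-0 row).  THEOREMS ONLY (no `def`, no instance, no notation, no `sorry`, default heartbeats);
★-only imports; states NO law; (β₂) stays a HYPOTHESIS.  Binders = `N` with the floor `m_c ≤ N` in front (★ lower worker's), then ‹OFF-A.letter.v2›'s block (lines 2–44 of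
`F0/P3a/F0P3a-p01/g38/laneA/OFF-A.letter.v2…`, = ‹OFF.letter.v2› with the type block swapped: `_hτ : |ρα − Θα| < 1`, no `_hres _hΘne _hDM`, plus `_hddE _hfixE _h2M`) BYTE FOR
BYTE, then ‹LINE-L-A-RAY.letter.v1› ec73df0224aa0ede's cell line `1 ≤ b → b < j → 2b + d%2 < m → j + b + d%2 = jl → mstarOfRecord d ≤ b + d%2 → IsOrd(lam)` + ONE inserted
premise `(∃ x : M, x ≠ 0 ∧ h * Θ x * x + ρ (h * Θ x * x) = 0) →`, conclusion = the letter's BYTE FOR BYTE (python tie: statement minus the premise == letter body, 7 166 chars).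

WHY (β₂ WORD #42: lane A = `laneA_of_leaves NA hNA` with leaf `hL_ray_A` = ‹LINE-L-A-RAY›; this seat 03:42:48Z scope).  LH7-p09's lower worker reads the M-side datum `_hDM` at six
places; in lane A (type U: `|α − ρα| = 1`, `|ρα − Θα| < 1`, `M ∕ Fix Θ` UNRAMIFIED, `Fix Θ ∕ F` the ramified third field) the datum is false, and the five W3-A substitutions plus
two RAY-band downgrades replace it: (1) SIZES — `…LowerLineSizeLettersRayA.lowerLine_sizeLetters_of_ray_A` from `|Θα − α| ≤ 1` (`g2` reads `m ≥ b + m⋆`, true on RAY);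
(2) PARITY — the Unr-K atlas ★ p861798 §3: a populated hyperbolic cell has `j = b + d + 2i` (`levelSet_unrK_hyper_eq_empty_of_lt ∕ _of_odd`); (3) `hFgap` — ★ p864540
`fgap_of_fixE`; the RamK dichotomy ∕ flip witness are dropped; (4) REFERENCE PAIR — road (I) ★ p864994 `exists_theta_refPair_of_typeU` at `k := d + i`: Θ-fixed `κ₀` with
`κ₀ + ρκ₀ = 1`, `|κ₀| = e^{d−1}`, anti Θ-fixed `ξ₀` with `|ξ₀| = e^{d+2i} = e^{j−b}` (so `|ξ₀|·|cc(α − ρα)| = |jEϖ|^b` EXACTLY and `|κ₀| ≤ |ξ₀|`); (5) W2 —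
`…LowerLineCellLettersAnyRadius.exists_cellLetters_lowerLine_of_radius` at `r = d + 2i`; (6) hI — ★ p864148 §6 `cls_iff_cls_and_v_sub_le_of_gen` (datum-free) at radius
`|jEϖ|^b ≤ |ϖ|^{2d−1}` ⟸ `2d − 1 ≤ b` ⟸ RAY; (7) hL₁∕hL₂ — ★ p865203 `reads_of_gen6_lowerLine_ray` with the PLAIN transfer letter `hγb : |γ₁|·|jEϖ|^b ≤ |ϖ|^{2d−1}` (`|γ₁| = 1`,
RAY); (8) hF — ★ p865033 `fibre_ncard_eq_of_lit_of_gen_typeU` (no class letters: every Θ-fixed unit is a Θ-norm on type U).  Everything else — ★ p863399 shell drop, the empty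
cell, the socket ★ p864098 at `r = |ϖ|^{2d−1}`, hV ∕ hP ★ R1b-A, hLit ★ p863983, hNX ∕ hψ ★ W1, hbase ★ F1 + ★ p864666 `litStar_iff_of_near_of_big` (`|jEϖ|·|ξ₀| = e^{d+2i−1} ≥ 1`)
— is LH7-p09's assembly token for token.  The ANISOTROPIC literal (`j = b + d − 1` by the atlas) is NOT treated here: its radius `e^{d−1}` carries no Θ-fixed chart (Θ-fixed anti
elements have order `≡ d (mod 2)`, this seat's ★ p864921 ∕ ★ p864975) — it is the residual letter ‹LINE-L-A-RAY-ANISO› of the assembler `offRowAL_ray_of_hyper_of_aniso`.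
* HEAD `cellDiff_lowerLine_ray_eq_zero_of_hyper_A (N) (hN)` — the worker.  Consumer: the lane-A assembler (‹LINE-L-A-RAY› ⟸ this + ‹LINE-L-A-RAY-ANISO›), then ★ g38
  `offRowAL_of_bands NA hL_ray_A (offRowALmix_of_hi NA hNA hL_mixhi_A)`.
HONEST LABEL.  Count-neutral; nothing printed is asserted; no census law is stated; ‹LINE-L-A-RAY› (aniso head), ‹LINE-L-A-MIX-HI› (the strip `d ≤ b < 2d − 1`, where `g2` and
the transfer need the `d − 1` digits lane A does not have) remain OPEN letters; `HC_CM` is proved only modulo the 7 printed citations (2 remaining named inputs: hLiu418 =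
`stmt-HodgeConjecture-24832`, h413 = `stmt-HodgeConjecture-24833`) until rung 0 closes.
## References
* [Kottwitz1986BaseChangeUnits] R. E. Kottwitz, *Base change for unit elements of Hecke algebras*, Compositio Math. 60 (1986): §1 pp. 240–241, §3.
* [Jacobowitz1962] R. Jacobowitz, *Hermitian forms over local fields*, Amer. J. Math. 84 (1962): §4.
* [Rogawski1990] J. D. Rogawski, *Automorphic Representations of Unitary Groups in Three Variables*, Ann. of Math. Stud. 123 (1990): §4.9 Prop. 4.9.1 (b) p. 55, §12.2.
* [Serre1979] J.-P. Serre, *Local Fields*, GTM 67 (1979): Ch. III §6 Prop. 12; Ch. V §2 Prop. 3, §3 Cor. 3; Ch. XV §2.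
-/

set_option autoImplicit false

noncomputable section

namespace Summit.HodgeConjecture.HodgeConjecture.Cruxes.H413.F0P3cDyRamBeta2ConesOffRowALowerRayWorkerHyper

open scoped Valued WithZero Matrix MatrixGroups Pointwise Classical
open WithZero Finset
open Literature.NumberTheory.Automorphic Literature.NumberTheory.Automorphic.HermitianLattice Literature.NumberTheory.Automorphic.UnitaryLatticeTree
open Literature.NumberTheory.Automorphic.UnitaryThreeFourFrame (IsRamifiedQuadraticDatum normSign)
open Literature.NumberTheory.Rogawski1990
open Summit.HodgeConjecture.HodgeConjecture.Cruxes.H413.F0P3cDyRamFourFramePieces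
open Summit.HodgeConjecture.HodgeConjecture.Cruxes.H413.F0P3cDyRamFourFrameCensusDefs (LatticeInLevel LatticeNearTransvShell)
open Summit.HodgeConjecture.HodgeConjecture.Cruxes.H413.F0P3cDyRamStageOneBDefs (mcOfRecord)
open Summit.HodgeConjecture.HodgeConjecture.Cruxes.H413.F0P3cDyRamToricCensusDefs
open Summit.HodgeConjecture.HodgeConjecture.Cruxes.H413.F0P3cDyRamRowCleanCellBit (line_entry_mul_map_eq_one)
open Summit.HodgeConjecture.HodgeConjecture.Cruxes.H413.F0P3cDyRamPieceRowsWildUnit0OfExports (v_two_lt_one_of_not_isUnit_two)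
open Summit.HodgeConjecture.HodgeConjecture.Cruxes.H413.F0P3cDyRamLabelShellFlipCardTwo (v_refSkew_eq)
open Summit.HodgeConjecture.HodgeConjecture.Cruxes.H413.F0P3cDyRamLowerLineShellFold (levelSetDep_inter_shell_and_eq_of_line)
open Summit.HodgeConjecture.HodgeConjecture.Cruxes.H413.F0P3cDyRamConeCellLedgerSizes (levelSetDep_eq_levelSet_of_add_le)
open Summit.HodgeConjecture.HodgeConjecture.Cruxes.H413.F0P3cDyRamDiagonalFixedClassSystems (exists_repr_fixedBall_card)
open Summit.HodgeConjecture.HodgeConjecture.Cruxes.H413.F0P3cDyRamRowCellSocketLit (lit_of_near_of_gen)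
open Summit.HodgeConjecture.HodgeConjecture.Cruxes.H413.F0P3cDyRamSphereLabelDigits (card_filter_sphere_plus_eq_card_filter_not)
open Summit.HodgeConjecture.HodgeConjecture.Cruxes.H413.F0P3cDyRamConeCellCountSocketDep (cellDiff_eq_zero_of_fibration_reads₄)
open Summit.HodgeConjecture.HodgeConjecture.Cruxes.H413.F0P3cDyRamRamKFrameClassLetters (deep_of_datum)
open Summit.HodgeConjecture.HodgeConjecture.Cruxes.H413.F0P3cDyRamLowerLineCellLettersAnyRadius (exists_cellLetters_lowerLine_of_radius)
open Summit.HodgeConjecture.HodgeConjecture.Cruxes.H413.F0P3cDyRamLowerLineSizeLettersRayA (lowerLine_sizeLetters_of_ray_A)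
open Summit.HodgeConjecture.HodgeConjecture.Cruxes.H413.F0P3cDyRamUnrKThetaFixedRefPair (exists_theta_refPair_of_typeU)
open Summit.HodgeConjecture.HodgeConjecture.Cruxes.H413.F0P3cDyRamRowCellSocketFibreTypeU (fibre_ncard_eq_of_lit_of_gen_typeU)
open Summit.HodgeConjecture.HodgeConjecture.Cruxes.H413.F0P3cDyRamUnrKFrameClassLetters (fgap_of_fixE)
open Summit.HodgeConjecture.HodgeConjecture.Cruxes.H413.F0P3cDyRamConeCellEmptyAtlas (levelSet_unrK_hyper_eq_empty_of_lt levelSet_unrK_hyper_eq_empty_of_odd)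
open Summit.HodgeConjecture.HodgeConjecture.Cruxes.H413.F0P3cDyRamUpperRayDigitConstancy (sphere_iff_of_near psi_iff_of_near)
open Summit.HodgeConjecture.HodgeConjecture.Cruxes.H413.F0P3cDyRamLowerLineDigitConstancy (litStar_iff_of_near_of_big)
open Summit.HodgeConjecture.HodgeConjecture.Cruxes.H413.F0P3cDyRamRowCellGeneratorIndependence (cls_iff_cls_and_v_sub_le_of_gen)
open Summit.HodgeConjecture.HodgeConjecture.Cruxes.H413.F0P3cDyRamUpperRayCellReads (exists_vertexFrame_of_gen weight_ne_zero_iff_cls_of_gen6)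
open Summit.HodgeConjecture.HodgeConjecture.Cruxes.H413.F0P3cDyRamLowerLineCellLiteralReadsRay (reads_of_gen6_lowerLine_ray)
open Summit.HodgeConjecture.HodgeConjecture.Cruxes.H413.F0P3cDyRamNormPairsIffFrames (normSign_eq_one_or)

/-- **HEAD — LANE A: «THE LOWER-LINE RAY CELL WORKER ON THE HYPERBOLIC TOWER».**  Binders: `N` with the floor `m_c ≤ N`; then ‹OFF-A.letter.v2›'s block BYTE FOR BYTE; then
the cell `(j, b)` with `1 ≤ b`, `b < j`, the lower line `2b + d%2 < m`, `j + b + d%2 = jl`, the RAY band `mstarOfRecord d ≤ b + d%2`, `IsOrd(lam)`, and the premise «`h`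
hyperbolic».  THEN the labelled (β₂) difference of the (OFF) residue's two lower-line literals over `levelSetDep(j, b; μ)` vanishes.  See the module docstring for the assembly.
[cite: Kottwitz1986BaseChangeUnits, §1 pp. 240–241; §3] [cite: Jacobowitz1962, §4] [cite: Rogawski1990, §4.9 Prop. 4.9.1 (b) p. 55] [cite: Serre1979, Ch. V §2 Prop. 3, §3 Cor. 3; Ch. XV §2] -/
theorem cellDiff_lowerLine_ray_eq_zero_of_hyper_A (N : ℕ → ℕ → ℕ → ℕ) (hN : ∀ d tE q, mcOfRecord d ≤ N d tE q) :
    ∀ (E M : Type) [Field E] [Valued E ℤᵐ⁰] [CompleteSpace E] [IsDiscreteValuationRing 𝒪[E]] [Finite 𝓀[E]]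
        [Field M] [Valued M ℤᵐ⁰] [CompleteSpace M] [IsDiscreteValuationRing 𝒪[M]] [Finite 𝓀[M]]
        (σ : E →+* E) (ϖ : E) (d tE : ℕ) (_hD : IsRamifiedQuadraticDatum σ ϖ d tE) (_hσσ : ∀ a, σ (σ a) = a) (_h2 : ¬ IsUnit (2 : 𝒪[E]))
        (jE : E →+* M) (ρ Θ : M →+* M) (α lam : M)
        (_hρρ : ∀ z, ρ (ρ z) = z) (_hvρ : ∀ z, Valued.v (ρ z) = Valued.v z) (_hρj : ∀ a, ρ (jE a) = jE a)
        (_hjv : ∀ a, Valued.v (jE a) ≤ 1 ↔ Valued.v a ≤ 1) (_hjfix : ∀ z : M, ρ z = z ↔ ∃ a, jE a = z) (_hΘj : ∀ a, Θ (jE a) = jE (σ a))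
        (_hΘΘ : ∀ z, Θ (Θ z) = z) (_hΘρ : ∀ z, Θ (ρ z) = ρ (Θ z)) (_hvΘ : ∀ z, Valued.v (Θ z) = Valued.v z)
        (_hα : ρ α ≠ α) (_hα1 : Valued.v α ≤ 1) (_hint : ∀ z : M, Valued.v z ≤ 1 → Valued.v ((z - ρ z) / (α - ρ α)) ≤ 1)
        (_hΘlam : Θ lam * lam = 1) (_hvlam : Valued.v lam = 1) (_hbasis : ∀ z : M, ∃! pq : E × E, z = jE pq.1 + jE pq.2 * lam)
        (_hU : Valued.v (α - ρ α) = 1) (_hτ : Valued.v (ρ α - Θ α) < 1)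
        (_hσres : ∀ z : M, ρ z = z → Valued.v z ≤ 1 → Valued.v (Θ z - z) < 1)
        (_hjiso : ∀ a, Valued.v (jE a) = Valued.v a)
        (_hq : Nat.card 𝓀[M] = Nat.card 𝓀[E] ^ 2) (_hddE : Valued.v (jE ϖ - Θ (jE ϖ)) = Valued.v (jE ϖ) ^ d)
        (_hfixE : ∀ z : M, ρ z = z → Θ z = z → z ≠ 0 → ∃ n : ℤ, Valued.v z = WithZero.exp (2 * n)) (_h2M : Valued.v (2 : M) = Valued.v (jE ϖ) ^ tE) (_hjpow : ∀ (t : E) (n : ℤ), Valued.v (jE t) = Valued.v (jE ϖ) ^ n ↔ Valued.v t = Valued.v ϖ ^ n)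
        (_hEval : ∀ c : M, ρ c = c → c ≠ 0 → Valued.v c ≤ 1 → ∃ n : ℕ, Valued.v c = Valued.v (jE ϖ) ^ n)
        (_hϖmax : ∀ t : M, ρ t = t → Valued.v t < 1 → Valued.v t ≤ Valued.v (jE ϖ))
        (γ₂ : GL (Fin 2) E) (u : GL (Fin 1) E)
        (_hdet : (γ₂ : Matrix (Fin 2) (Fin 2) E).det * σ (γ₂ : Matrix (Fin 2) (Fin 2) E).det = 1)
        (_htr : (γ₂ : Matrix (Fin 2) (Fin 2) E).trace = (γ₂ : Matrix (Fin 2) (Fin 2) E).det * σ (γ₂ : Matrix (Fin 2) (Fin 2) E).trace)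
        (_hirr : ∀ x : E, x * x - (γ₂ : Matrix (Fin 2) (Fin 2) E).trace * x + (γ₂ : Matrix (Fin 2) (Fin 2) E).det ≠ 0)
        (_hlam2 : lam * lam = jE (γ₂ : Matrix (Fin 2) (Fin 2) E).trace * lam - jE (γ₂ : Matrix (Fin 2) (Fin 2) E).det)
        (_hρlam : ρ lam = jE (γ₂ : Matrix (Fin 2) (Fin 2) E).trace - lam) (m jl : ℕ) (_hm : Valued.v (lam - jE ((u : Matrix (Fin 1) (Fin 1) E) 0 0)) = WithZero.exp (-(m : ℤ)))
        (_hjl : Valued.v ((lam - jE ((u : Matrix (Fin 1) (Fin 1) E) 0 0)) - ρ (lam - jE ((u : Matrix (Fin 1) (Fin 1) E) 0 0))) = WithZero.exp (-(jl : ℤ)))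
        (_hs : Valued.v ((γ₂ : Matrix (Fin 2) (Fin 2) E).trace - 2) * Valued.v (ϖ ^ (d % 2)) ≤ Valued.v (ϖ ^ mcOfRecord d))
        (_hp : Valued.v ((γ₂ : Matrix (Fin 2) (Fin 2) E).det - (γ₂ : Matrix (Fin 2) (Fin 2) E).trace + 1) ≤ Valued.v (ϖ ^ mcOfRecord d))
        (_hNm : N d tE (Nat.card 𝓀[E]) ≤ m) (_hu1N : Valued.v (((u : Matrix (Fin 1) (Fin 1) E) 0 0) - 1) ≤ Valued.v (ϖ ^ N d tE (Nat.card 𝓀[E]))) (_hlam1 : Valued.v (lam - 1) ≤ Valued.v (jE ϖ ^ N d tE (Nat.card 𝓀[E])))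
        (_hu : Valued.v ((u : Matrix (Fin 1) (Fin 1) E) 0 0) = 1) (_hum : Valued.v (((u : Matrix (Fin 1) (Fin 1) E) 0 0) - 1) ≤ Valued.v (ϖ ^ mstarOfRecord d))
        (H₂ : Matrix (Fin 2) (Fin 2) E) (hW : E) (_hH₂ : IsUnit H₂.det) (_hH₂σ : (H₂.map σ)ᵀ = H₂) (_hhW : Valued.v hW = 1) (_hhWσ : σ hW = hW)
        (P₁ : GL (Fin 3) E) (_hA : formCongr σ P₁ ((StdForm.antidiagonal 3).over E) = (!![H₂ 0 0, 0, H₂ 0 1; 0, hW, 0; H₂ 1 0, 0, H₂ 1 1] : Matrix (Fin 3) (Fin 3) E))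
        (_hΓ : P₁ * endoGL (γ₂, u) * P₁⁻¹ ∈ unitaryGroupOfForm σ ((StdForm.antidiagonal 3).over E))
        (φ : (Fin 2 → E) →+ M) (h : M) (_hφs : ∀ (c : E) (x : Fin 2 → E), φ (c • x) = jE c * φ x) (_hφi : Function.Injective φ) (_hφo : Function.Surjective φ)
        (_hφγ : ∀ x, φ ((γ₂ : Matrix (Fin 2) (Fin 2) E).mulVec x) = lam * φ x)
        (_hform : ∀ x y, jE (pairing σ H₂ x y) = h * Θ (φ x) * φ y + ρ (h * Θ (φ x) * φ y)) (_hΘh : Θ h = h) (_hh : h ≠ 0)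
        (J R : ℕ) (f : ℕ → ℕ → AddSubgroup M → ℕ)
        (_hfinF : {L₃ : Submodule 𝒪[E] (Fin 3 → E) | IsSelfDualLattice σ ϖ (!![H₂ 0 0, 0, H₂ 0 1; 0, hW, 0; H₂ 1 0, 0, H₂ 1 1] : Matrix (Fin 3) (Fin 3) E) L₃ ∧ mapGL (endoGL (γ₂, u)) L₃ = L₃}.Finite)
        (_hR : ∀ L₃ : Submodule 𝒪[E] (Fin 3 → E), IsSelfDualLattice σ ϖ (!![H₂ 0 0, 0, H₂ 0 1; 0, hW, 0; H₂ 1 0, 0, H₂ 1 1] : Matrix (Fin 3) (Fin 3) E) L₃ →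
          mapGL (endoGL (γ₂, u)) L₃ = L₃ → ∀ b : ℕ, (∀ c : E, (Pi.single 1 c : Fin 3 → E) ∈ L₃ ↔ Valued.v c ≤ Valued.v ϖ ^ b) → b ≤ R)
        (_hJ : ¬ IsOrd ρ α (jE ϖ ^ (J + 1)) lam) (_hfinLS : ∀ j a, (levelSet ρ Θ α (jE ϖ) h j a).Finite)
        (_hf : ∀ (b j : ℕ) (Λ : AddSubgroup M) (x₀ : M) (r : E), 1 ≤ b → x₀ ≠ 0 → (∀ x, x ∈ Λ ↔ ∃ z, IsOrd ρ α (jE ϖ ^ j) z ∧ x = x₀ * z) →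
          IsOrd ρ α (jE ϖ ^ j) (dualGen ρ Θ α (jE ϖ ^ j) h x₀) → ¬ IsOrd ρ α (jE ϖ ^ j) (dualGen ρ Θ α (jE ϖ ^ j) h x₀ / jE ϖ) → Valued.v (dualGen ρ Θ α (jE ϖ ^ j) h x₀) = Valued.v (jE ϖ) ^ b →
          (∀ b', (∀ x ∈ Λ, Valued.v (h * Θ x * b' + ρ (h * Θ x * b')) ≤ 1) → (lam - jE ((u : Matrix (Fin 1) (Fin 1) E) 0 0)) * b' ∈ Λ) → IsOrd ρ α (jE ϖ ^ j) lam →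
          jE r = glueUnit ρ Θ α (jE ϖ ^ j) h (jE ϖ) (jE hW) x₀ b →
          f b j Λ = Nat.card {x : 𝒪[E] ⧸ 𝓂[E] ^ (2 * b) // ∃ u' : 𝒪[E], Ideal.Quotient.mk (𝓂[E] ^ (2 * b)) u' = x ∧ Valued.v ((u' : E) * σ u' - r) ≤ Valued.v (ϖ ^ (2 * b))}),
        ∀ j b : ℕ, 1 ≤ b → b < j → 2 * b + d % 2 < m → j + b + d % 2 = jl → mstarOfRecord d ≤ b + d % 2 → IsOrd ρ α (jE ϖ ^ j) lam →
          (∃ x : M, x ≠ 0 ∧ h * Θ x * x + ρ (h * Θ x * x) = 0) →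
                ((∑ᶠ Λ ∈ levelSetDep ρ Θ α (jE ϖ) h j b (lam - jE ((u : Matrix (Fin 1) (Fin 1) E) 0 0)) ∩
                      {Λ | ∃ B : Submodule 𝒪[E] (Fin 2 → E), B.toAddSubgroup.map φ = Λ ∧
                        ∃ L₃ : Submodule 𝒪[E] (Fin 3 → E), IsSelfDualLattice σ ϖ (!![H₂ 0 0, 0, H₂ 0 1; 0, hW, 0; H₂ 1 0, 0, H₂ 1 1] : Matrix (Fin 3) (Fin 3) E) L₃ ∧
                          L₃ ⊓ LinearMap.ker ((LinearMap.proj (1 : Fin 3) : (Fin 3 → E) →ₗ[E] E).restrictScalars 𝒪[E]) =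
                            B.map ((Matrix.toLin' (!![1, 0; 0, 0; 0, 1] : Matrix (Fin 3) (Fin 2) E)).restrictScalars 𝒪[E]) ∧
                          (∀ c : E, (Pi.single 1 c : Fin 3 → E) ∈ L₃ ↔ Valued.v c ≤ Valued.v ϖ ^ b) ∧
                          (LatticeNearTransvShell ϖ (d % 2) (mstarOfRecord d) ((((endoGL (γ₂, u) : GL (Fin 3) E) : Matrix (Fin 3) (Fin 3) E) - 1)) L₃ ∧
                            {z : E | ∃ y ∈ L₃, Valued.v ((ϖ ^ (mstarOfRecord d))⁻¹ * (z - pairing σ (!![H₂ 0 0, 0, H₂ 0 1; 0, hW, 0; H₂ 1 0, 0, H₂ 1 1] : Matrix (Fin 3) (Fin 3) E) y (((((endoGL (γ₂, u) : GL (Fin 3) E) : Matrix (Fin 3) (Fin 3) E) - 1)) *ᵥ y))) ≤ 1} =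
                              valueSetMod σ ϖ (mstarOfRecord d) (xPlus σ ϖ d))}, f b j Λ : ℕ) : ℤ) -
                  ((∑ᶠ Λ ∈ levelSetDep ρ Θ α (jE ϖ) h j b (lam - jE ((u : Matrix (Fin 1) (Fin 1) E) 0 0)) ∩
                      {Λ | ∃ B : Submodule 𝒪[E] (Fin 2 → E), B.toAddSubgroup.map φ = Λ ∧
                        ∃ L₃ : Submodule 𝒪[E] (Fin 3 → E), IsSelfDualLattice σ ϖ (!![H₂ 0 0, 0, H₂ 0 1; 0, hW, 0; H₂ 1 0, 0, H₂ 1 1] : Matrix (Fin 3) (Fin 3) E) L₃ ∧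
                          L₃ ⊓ LinearMap.ker ((LinearMap.proj (1 : Fin 3) : (Fin 3 → E) →ₗ[E] E).restrictScalars 𝒪[E]) =
                            B.map ((Matrix.toLin' (!![1, 0; 0, 0; 0, 1] : Matrix (Fin 3) (Fin 2) E)).restrictScalars 𝒪[E]) ∧
                          (∀ c : E, (Pi.single 1 c : Fin 3 → E) ∈ L₃ ↔ Valued.v c ≤ Valued.v ϖ ^ b) ∧
                          (LatticeNearTransvShell ϖ (d % 2) (mcOfRecord d) ((((endoGL (γ₂, u) : GL (Fin 3) E) : Matrix (Fin 3) (Fin 3) E) - 1)) L₃ ∧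
                            ¬ {z : E | ∃ y ∈ L₃, Valued.v ((ϖ ^ (mstarOfRecord d))⁻¹ * (z - pairing σ (!![H₂ 0 0, 0, H₂ 0 1; 0, hW, 0; H₂ 1 0, 0, H₂ 1 1] : Matrix (Fin 3) (Fin 3) E) y (((((endoGL (γ₂, u) : GL (Fin 3) E) : Matrix (Fin 3) (Fin 3) E) - 1)) *ᵥ y))) ≤ 1} =
                              valueSetMod σ ϖ (mstarOfRecord d) (xPlus σ ϖ d))}, f b j Λ : ℕ) : ℤ) = 0 := by
  intro E M _ _ _ _ _ _ _ _ _ _ σ ϖ d tE _hD _hσσ _h2 jE ρ Θ α lam _hρρ _hvρ _hρj _hjv _hjfix _hΘj _hΘΘ _hΘρ _hvΘ _hα _hα1 _hint _hΘlam _hvlam _hbasis _hU _hτ _hσres _hjiso _hq _hddE _hfixE _h2M _hjpow _hEval _hϖmax γ₂ u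
    _hdet _htr _hirr _hlam2 _hρlam m jl _hm _hjl _hs _hp _hNm _hu1N _hlam1 _hu _hum H₂ hW _hH₂ _hH₂σ _hhW _hhWσ P₁ _hA _hΓ φ h _hφs _hφi _hφo _hφγ _hform _hΘh _hh J R f _hfinF _hR _hJ
    _hfinLS _hf j b hb1 hbj h2bm hline hray hlamj hhyper
  -- the record's levels, the floor, basic sizes
  obtain ⟨hσ, hvσ, hϖ, hfixE, hd, hd1, -⟩ := id _hD
  have hvϖ0 : Valued.v ϖ ≠ 0 := by rw [hϖ]; exact exp_ne_zero
  have hϖ0 : ϖ ≠ 0 := fun h0 => hvϖ0 (by rw [h0, map_zero])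
  have hϖlt : Valued.v ϖ < 1 := by rw [hϖ, ← exp_zero, exp_lt_exp]; norm_num
  have hϖle : Valued.v ϖ ≤ 1 := hϖlt.le
  have hjϖ : Valued.v (jE ϖ) = exp (-1 : ℤ) := by rw [_hjiso, hϖ]
  have hjϖ0 : jE ϖ ≠ 0 := (map_ne_zero jE).2 hϖ0
  have hjϖle : Valued.v (jE ϖ) ≤ 1 := by rw [_hjiso]; exact hϖle
  have hPn : ∀ n : ℕ, Valued.v (jE ϖ) ^ n = exp (-(n : ℤ)) := fun n => by rw [hjϖ, ← exp_nsmul]; congr 1; simp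
  have hPnE : ∀ n : ℕ, Valued.v ϖ ^ n = exp (-(n : ℤ)) := fun n => by rw [hϖ, ← exp_nsmul]; congr 1; simp
  have h2v : Valued.v (2 : E) < 1 := v_two_lt_one_of_not_isUnit_two _h2
  have hhW0 : hW ≠ 0 := fun h0 => by rw [h0, map_zero] at _hhW; exact zero_ne_one _hhW
  have huu := line_entry_mul_map_eq_one σ hhW0 _hA _hΓ
  have hhW1 : Valued.v (jE hW) = 1 := by rw [_hjiso, _hhW]
  have hms : mstarOfRecord d = d % 2 + 2 * d - 1 := rfl
  have hmc : mcOfRecord d = 2 * ((mstarOfRecord d + d) / 2) := rfl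
  have hmcN : mcOfRecord d ≤ N d tE (Nat.card 𝓀[E]) := hN d tE (Nat.card 𝓀[E])
  have hmcm : mcOfRecord d ≤ m := hmcN.trans _hNm
  have hdb : d ≤ b := by rw [hms] at hray; omega
  have hb2d : 2 * d - 1 ≤ b := by rw [hms] at hray; omega
  have hn : 3 * d - 2 + d % 2 = mcOfRecord d := by rw [hmc, hms]; omega
  have hmc3 : 3 * d - 2 + d % 2 ≤ m := by rw [hn]; exact hmcm
  have h2d1 : Valued.v ϖ ^ (2 * d - 1) < 1 := pow_lt_one₀ zero_le hϖlt (by omega)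
  have hccv : Valued.v (jE ϖ ^ j * (α - ρ α)) = exp (-(j : ℤ)) := by rw [Valuation.map_mul, _hU, mul_one, Valuation.map_pow, hPn]
  have hcc : jE ϖ ^ j * (α - ρ α) ≠ 0 := fun h0 => by rw [h0, map_zero] at hccv; exact exp_ne_zero hccv.symm
  have hμρ : ρ (lam - jE ((u : Matrix (Fin 1) (Fin 1) E) 0 0)) ≠ lam - jE ((u : Matrix (Fin 1) (Fin 1) E) 0 0) := fun h0 => by
    have h1 := _hjl
    rw [h0, sub_self, map_zero] at h1; exact exp_ne_zero h1.symm
  -- LANE A: the lower-line sizes on the RAY band, datum-free (`|Θα − α| ≤ 1`; this seat's `…LowerLineSizeLettersRayA`)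
  have hΘα : Valued.v (Θ α - α) ≤ 1 := (Valuation.map_sub _ _ _).trans (max_le (by rw [_hvΘ]; exact _hα1) _hα1)
  obtain ⟨hμle, hanti, g1, g2, g3, gsk, -⟩ := lowerLine_sizeLetters_of_ray_A (ρ := ρ) (j := j) hjϖ hΘα _hU _hm _hjl h2bm hline hray hmcm
  -- ★ p863399: both shell conjuncts DROP on the lower line (`M := m⋆` with `k = m⋆ − ℓ₀`, `M := m_c` with `k = m_c − ℓ₀`)
  have hμks : Valued.v (lam - jE ((u : Matrix (Fin 1) (Fin 1) E) 0 0)) ≤ Valued.v (jE ϖ) ^ (mstarOfRecord d - d % 2) := by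
    rw [_hm, hPn, exp_le_exp]; omega
  have huks : Valued.v ((u : Matrix (Fin 1) (Fin 1) E) 0 0 - 1) ≤ Valued.v (ϖ ^ (mstarOfRecord d - d % 2)) :=
    _hum.trans (by rw [Valuation.map_pow, Valuation.map_pow]; exact pow_le_pow_right_of_le_one' hϖle (by omega))
  have hμkc : Valued.v (lam - jE ((u : Matrix (Fin 1) (Fin 1) E) 0 0)) ≤ Valued.v (jE ϖ) ^ (mcOfRecord d - d % 2) := by
    rw [_hm, hPn, exp_le_exp]; omega
  have hukc : Valued.v ((u : Matrix (Fin 1) (Fin 1) E) 0 0 - 1) ≤ Valued.v (ϖ ^ (mcOfRecord d - d % 2)) :=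
    _hu1N.trans (by rw [Valuation.map_pow, Valuation.map_pow]; exact pow_le_pow_right_of_le_one' hϖle (by omega))
  have eP := levelSetDep_inter_shell_and_eq_of_line σ hσ hvσ hϖ _hH₂ _hH₂σ _hhW jE _hρρ _hvρ _hα _hα1 _hint _hΘΘ _hΘρ _hvΘ _hjv _hjfix _hjpow _hϖmax
    φ _hφs _hφi _hφo _hφγ _hvlam _hΘh _hh _hform u (d % 2) (mstarOfRecord d - d % 2) (mstarOfRecord d) (by omega) (m' := mstarOfRecord d - d % 2) (by omega) le_rfl
    huks hb1 hbj hlamj hμks hμle hanti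
    (fun L₃ => {z : E | ∃ y ∈ L₃, Valued.v ((ϖ ^ (mstarOfRecord d))⁻¹ * (z - pairing σ (!![H₂ 0 0, 0, H₂ 0 1; 0, hW, 0; H₂ 1 0, 0, H₂ 1 1] : Matrix (Fin 3) (Fin 3) E) y
        (((((endoGL (γ₂, u) : GL (Fin 3) E) : Matrix (Fin 3) (Fin 3) E) - 1)) *ᵥ y))) ≤ 1} = valueSetMod σ ϖ (mstarOfRecord d) (xPlus σ ϖ d))
  have eQ := levelSetDep_inter_shell_and_eq_of_line σ hσ hvσ hϖ _hH₂ _hH₂σ _hhW jE _hρρ _hvρ _hα _hα1 _hint _hΘΘ _hΘρ _hvΘ _hjv _hjfix _hjpow _hϖmax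
    φ _hφs _hφi _hφo _hφγ _hvlam _hΘh _hh _hform u (d % 2) (mcOfRecord d - d % 2) (mcOfRecord d) (by omega) (m' := mcOfRecord d - d % 2) (by omega) le_rfl
    hukc hb1 hbj hlamj hμkc hμle hanti
    (fun L₃ => ¬ {z : E | ∃ y ∈ L₃, Valued.v ((ϖ ^ (mstarOfRecord d))⁻¹ * (z - pairing σ (!![H₂ 0 0, 0, H₂ 0 1; 0, hW, 0; H₂ 1 0, 0, H₂ 1 1] : Matrix (Fin 3) (Fin 3) E) y
        (((((endoGL (γ₂, u) : GL (Fin 3) E) : Matrix (Fin 3) (Fin 3) E) - 1)) *ᵥ y))) ≤ 1} = valueSetMod σ ϖ (mstarOfRecord d) (xPlus σ ϖ d))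
  beta_reduce at eP eQ
  rw [eP, eQ]
  -- the empty cell
  by_cases hempty : levelSet ρ Θ α (jE ϖ) h j b = ∅
  · have h0 : levelSetDep ρ Θ α (jE ϖ) h j b (lam - jE ((u : Matrix (Fin 1) (Fin 1) E) 0 0)) = ∅ :=
      Set.subset_eq_empty (levelSetDep_subset ρ Θ α (jE ϖ) h j b _) hempty
    rw [h0, Set.empty_inter, Set.empty_inter, finsum_mem_empty, Nat.cast_zero, sub_self]
  obtain ⟨Λ₀, hΛ₀⟩ := Set.nonempty_iff_ne_empty.2 hempty
  obtain ⟨x₀₀, -, -, -, -, hylev₀⟩ := hΛ₀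
  -- LANE A: the PARITY is the Unr-K atlas (★ p861798 §3) — a populated HYPERBOLIC cell sits on the tower `j = b + d + 2i`
  have hge : b + d ≤ j := by
    by_contra hlt
    exact hempty (levelSet_unrK_hyper_eq_empty_of_lt _hρρ _hvρ _hΘΘ _hΘρ _hvΘ _hα1 _hU (_hρj ϖ) hjϖ _hq _hτ hd1 _hddE _hfixE _hΘh _hh hhyper hb1 (by omega))
  have hev : (j - b - d) % 2 = 0 := by
    by_contra hodd
    exact hempty (levelSet_unrK_hyper_eq_empty_of_odd _hρρ _hvρ _hΘΘ _hΘρ _hvΘ _hα1 _hU (_hρj ϖ) hjϖ _hq _hτ hd1 _hddE _hfixE _hΘh _hh hhyper hb1 (by omega))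
  obtain ⟨i, hjbi⟩ : ∃ i : ℕ, j = b + (d + 2 * i) := ⟨(j - b - d) / 2, by omega⟩
  -- the class letters that HOLD on type U (★ p864540; ★ `deep_of_datum` is lane-free); the RamK unit dichotomy and flip witness are neither available nor needed
  have hFgap := fgap_of_fixE (ρ := ρ) (Θ := Θ) hjϖ _hfixE
  have hdeep2 := deep_of_datum (ρ := ρ) _hD jE _hjv _hjfix _hΘj (n := 2 * d) (by omega)
  have hdeep1 := deep_of_datum (ρ := ρ) _hD jE _hjv _hjfix _hΘj (n := 2 * d - 1) le_rfl
  -- the Θ-FIXED reference pair of the ramified third field (road (I), ★ p864994): `|κ₀| = exp(d − 1)`, `|ξ₀| = exp(d + 2i)` = the cell's radius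
  obtain ⟨κ₀, ξ₀, hκ₀, hΘκ₀, hξ, hΘξ, hξ0, hκ₀d, hξv'⟩ :=
    exists_theta_refPair_of_typeU _hD jE _hρρ _hvρ _hρj _hΘj _hΘΘ _hΘρ _hvΘ _hα1 _hU _hτ _hjiso _hq _hddE _hfixE ((d : ℤ) + i)
  have hξv : Valued.v ξ₀ = exp ((d + 2 * i : ℕ) : ℤ) := by rw [hξv']; congr 1; push_cast; ring
  have hκ₀v : Valued.v κ₀ ≤ Valued.v ξ₀ := by rw [hκ₀d, hξv, exp_le_exp]; push_cast; omega
  have hlam3 : Valued.v (lam - 1) ≤ Valued.v (jE ϖ) ^ (3 * d - 2) :=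
    _hlam1.trans (by rw [Valuation.map_pow]; exact pow_le_pow_right_of_le_one' hjϖle (by omega))
  obtain ⟨W, BE, γ₁, W₁, hWc, hBE, hσγ, hσW₁, hθ, hWW, hγ1, hW₁1⟩ :=
    exists_cellLetters_lowerLine_of_radius (ρ := ρ) (Θ := Θ) _hD jE _hjiso _hjfix _hΘj _hρρ _hvρ _hΘρ _hΘlam _hvlam _hdet _hlam2 _hρlam hlam3 huu _hu _hm _hjl hjbi hline
      h2bm hmc3 hκ₀ hΘκ₀ hξ hΘξ hξ0 hκ₀v hξv
  -- sizes in the cell currency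
  have hRe : Valued.v ξ₀ * Valued.v (jE ϖ ^ j * (α - ρ α)) = Valued.v (jE ϖ) ^ b := by rw [hξv, hccv, hPn, ← exp_add]; congr 1; omega
  have hR : Valued.v (jE ϖ) ^ b ≤ Valued.v ξ₀ * Valued.v (jE ϖ ^ j * (α - ρ α)) := hRe.ge
  have hξpos : (0 : ℤᵐ⁰) < Valued.v ξ₀ := zero_lt_iff.2 ((Valuation.ne_zero_iff _).2 hξ0)
  have hbig : 1 ≤ Valued.v (jE ϖ) * Valued.v ξ₀ := by rw [hjϖ, hξv, ← exp_add, ← exp_zero, exp_le_exp]; omega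
  have h2M : Valued.v (2 : M) ≤ Valued.v (jE ϖ) := by
    have h2jlt : Valued.v (jE (2 : E)) < 1 := by rw [_hjiso]; exact h2v
    rw [map_ofNat] at h2jlt
    exact _hϖmax 2 (map_ofNat ρ 2) h2jlt
  -- the dyadic fence forces `2 ≤ d` (★ Lit `two_le_of_v_two_lt_one`)
  have hd2 : 2 ≤ d := Literature.NumberTheory.LocalFields.WildQuadraticDatum.two_le_of_v_two_lt_one hσ hvσ hfixE hϖ hd _hD.2.2.2.2.2.2 h2v
  have hlamn : Valued.v (lam - 1) ≤ Valued.v (jE ϖ) ^ mcOfRecord d :=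
    _hlam1.trans (by rw [Valuation.map_pow]; exact pow_le_pow_right_of_le_one' hjϖle hmcN)
  have hun : Valued.v ((u : Matrix (Fin 1) (Fin 1) E) 0 0 - 1) ≤ Valued.v ϖ ^ mcOfRecord d :=
    _hu1N.trans (by rw [Valuation.map_pow]; exact pow_le_pow_right_of_le_one' hϖle hmcN)
  have hnmc : 3 * d - 2 + d % 2 ≤ mcOfRecord d := hn.le
  -- LANE A: the PLAIN transfer letter of `…LowerLineCellLiteralReadsRay`: `|γ₁|·|jEϖ|^b ≤ |ϖ|^{2d−1}` ⟸ `2d − 1 ≤ b` (RAY)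
  have hγb : Valued.v γ₁ * Valued.v (jE ϖ) ^ b ≤ Valued.v ϖ ^ (2 * d - 1) := by
    rw [hγ1, one_mul, hPn, hPnE, exp_le_exp]; omega
  -- `P = (ϖσϖ)^b`, `t₊`, the strict slope letter
  have hP0 : (ϖ * σ ϖ) ^ b ≠ 0 := pow_ne_zero _ (mul_ne_zero hϖ0 ((map_ne_zero σ).2 hϖ0))
  have hσP : σ ((ϖ * σ ϖ) ^ b) = (ϖ * σ ϖ) ^ b := by rw [map_pow, map_mul, hσ, mul_comm (σ ϖ) ϖ]
  -- digit perturbations on `r`-balls, `r = |ϖ|^{2d−1}`, `|γ₁| = 1`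
  have hball : ∀ Ve V₀ : E, Valued.v (Ve - V₀) ≤ Valued.v ϖ ^ (2 * d - 1) →
      Valued.v (γ₁ * (V₀ - Ve)) ≤ Valued.v ϖ ^ (2 * d - 1) ∧ Valued.v (γ₁ * (V₀ - Ve)) < 1 := by
    intro Ve V₀ hle
    have h1 : Valued.v (γ₁ * (V₀ - Ve)) ≤ Valued.v ϖ ^ (2 * d - 1) := by
      rw [Valuation.map_mul, hγ1, one_mul, Valuation.map_sub_swap]; exact hle
    exact ⟨h1, h1.trans_lt h2d1⟩
  -- the class system of fixed digits modulo `r`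
  obtain ⟨Rd, hRd1, hRd2, hRd3, -⟩ := exists_repr_fixedBall_card hσ hvσ hfixE hϖ hd (2 * d - 1) 0
  simp only [Nat.mul_zero, pow_zero, Nat.add_zero] at hRd1 hRd2 hRd3
  -- ★ p864078's radii at `r = r₀ = |ϖ|^{2d−1}`
  have hrR : Valued.v ϖ ^ (2 * d - 1) * Valued.v ξ₀ * Valued.v (jE ϖ ^ j * (α - ρ α)) < Valued.v (jE ϖ) ^ b := by
    rw [mul_assoc, hRe, hPn, hPnE, ← exp_add, exp_lt_exp]; omega
  have hr₀ : Valued.v ϖ ^ (2 * d - 1) * Valued.v ξ₀ * Valued.v (jE ϖ ^ j * (α - ρ α)) ≤ Valued.v (jE ϖ) ^ (2 * d - 1) * Valued.v (jE ϖ) ^ b := by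
    rw [mul_assoc, hRe, hPn, hPn, hPnE]
  -- below the row the depth clause is AUTOMATIC: `levelSetDep(j, b; μ) = levelSet(j, b)` (`2b ≤ m`, `j + b ≤ jl`)
  have hcell : levelSetDep ρ Θ α (jE ϖ) h j b (lam - jE ((u : Matrix (Fin 1) (Fin 1) E) 0 0)) = levelSet ρ Θ α (jE ϖ) h j b :=
    levelSetDep_eq_levelSet_of_add_le _hρρ _hvρ _hΘΘ _hΘρ _hvΘ _hα1 _hU (_hρj ϖ) hjϖ _hh _hm _hjl hb1 (by omega) (by omega)
  have hdepAll : ∀ (Λ : AddSubgroup M) (x₀ : M), (x₀ ≠ 0 ∧ (∀ x, x ∈ Λ ↔ ∃ ζ, IsOrd ρ α (jE ϖ ^ j) ζ ∧ x = x₀ * ζ) ∧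
          IsOrd ρ α (jE ϖ ^ j) (dualGen ρ Θ α (jE ϖ ^ j) h x₀) ∧ ¬ IsOrd ρ α (jE ϖ ^ j) (dualGen ρ Θ α (jE ϖ ^ j) h x₀ / jE ϖ) ∧
          Valued.v (dualGen ρ Θ α (jE ϖ ^ j) h x₀) = Valued.v (jE ϖ) ^ b) →
      (∀ b', (∀ x ∈ Λ, Valued.v (h * Θ x * b' + ρ (h * Θ x * b')) ≤ 1) → (lam - jE ((u : Matrix (Fin 1) (Fin 1) E) 0 0)) * b' ∈ Λ) := by
    intro Λ x₀ hG5
    have hmem : Λ ∈ levelSet ρ Θ α (jE ϖ) h j b := ⟨x₀, hG5.1, hG5.2.1, hG5.2.2.1, hG5.2.2.2.1, hG5.2.2.2.2⟩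
    rw [← hcell] at hmem
    exact hmem.2
  -- «GEN6-fibre = GEN5-fibre»
  have hfib : ∀ y : E,
      {Λ : AddSubgroup M | ∃ x₀ : M, (x₀ ≠ 0 ∧ (∀ x, x ∈ Λ ↔ ∃ ζ, IsOrd ρ α (jE ϖ ^ j) ζ ∧ x = x₀ * ζ) ∧
          IsOrd ρ α (jE ϖ ^ j) (dualGen ρ Θ α (jE ϖ ^ j) h x₀) ∧ ¬ IsOrd ρ α (jE ϖ ^ j) (dualGen ρ Θ α (jE ϖ ^ j) h x₀ / jE ϖ) ∧
          Valued.v (dualGen ρ Θ α (jE ϖ ^ j) h x₀) = Valued.v (jE ϖ) ^ b ∧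
          (∀ b', (∀ x ∈ Λ, Valued.v (h * Θ x * b' + ρ (h * Θ x * b')) ≤ 1) → (lam - jE ((u : Matrix (Fin 1) (Fin 1) E) 0 0)) * b' ∈ Λ)) ∧ ((∃ e : M, ρ e = e ∧ e * Θ e = h * (x₀ * Θ x₀) + ρ (h * (x₀ * Θ x₀))) ↔ (∃ e : M, ρ e = e ∧ e * Θ e = -(h * ρ h * ((α - ρ α) * Θ (α - ρ α)) * jE hW))) ∧ Valued.v (((ρ (h * (x₀ * Θ x₀)) / (h * (x₀ * Θ x₀) + ρ (h * (x₀ * Θ x₀))) - κ₀) / ξ₀) - jE y) ≤ Valued.v ϖ ^ (2 * d - 1)} =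
      {Λ : AddSubgroup M | ∃ x₀ : M, (x₀ ≠ 0 ∧ (∀ x, x ∈ Λ ↔ ∃ ζ, IsOrd ρ α (jE ϖ ^ j) ζ ∧ x = x₀ * ζ) ∧
          IsOrd ρ α (jE ϖ ^ j) (dualGen ρ Θ α (jE ϖ ^ j) h x₀) ∧ ¬ IsOrd ρ α (jE ϖ ^ j) (dualGen ρ Θ α (jE ϖ ^ j) h x₀ / jE ϖ) ∧
          Valued.v (dualGen ρ Θ α (jE ϖ ^ j) h x₀) = Valued.v (jE ϖ) ^ b) ∧ ((∃ e : M, ρ e = e ∧ e * Θ e = h * (x₀ * Θ x₀) + ρ (h * (x₀ * Θ x₀))) ↔ (∃ e : M, ρ e = e ∧ e * Θ e = -(h * ρ h * ((α - ρ α) * Θ (α - ρ α)) * jE hW))) ∧ Valued.v (((ρ (h * (x₀ * Θ x₀)) / (h * (x₀ * Θ x₀) + ρ (h * (x₀ * Θ x₀))) - κ₀) / ξ₀) - jE y) ≤ Valued.v ϖ ^ (2 * d - 1)} := by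
    intro y
    ext Λ
    constructor
    · rintro ⟨x₀, ⟨hx₀, hΛx, hyO, hyp, hylev, -⟩, hC, hnear⟩
      exact ⟨x₀, ⟨hx₀, hΛx, hyO, hyp, hylev⟩, hC, hnear⟩
    · rintro ⟨x₀, hG5, hC, hnear⟩
      exact ⟨x₀, ⟨hG5.1, hG5.2.1, hG5.2.2.1, hG5.2.2.2.1, hG5.2.2.2.2, hdepAll Λ x₀ hG5⟩, hC, hnear⟩
  -- ★ p864098, the count socket at `r = |ϖ|^{2d−1}`
  refine cellDiff_eq_zero_of_fibration_reads₄ σ hσ hvσ hϖ _hD h2v _hH₂σ _hhW _hhWσ jE _hρρ _hvρ _hα _hα1 _hint _hΘΘ _hΘρ _hvΘ _hΘj _hjv _hjfix _hjpow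
    _hϖmax φ _hφs _hφi _hφo _hφγ _hvlam _hΘh _hh _hform ((u : Matrix (Fin 1) (Fin 1) E) 0 0) hb1 hdb hlamj f _hf _hjiso (_hfinLS j b)
    (fun x₀ => (∃ e : M, ρ e = e ∧ e * Θ e = h * (x₀ * Θ x₀) + ρ (h * (x₀ * Θ x₀)))) (fun x₀ => ((ρ (h * (x₀ * Θ x₀)) / (h * (x₀ * Θ x₀) + ρ (h * (x₀ * Θ x₀))) - κ₀) / ξ₀)) (∃ e : M, ρ e = e ∧ e * Θ e = -(h * ρ h * ((α - ρ α) * Θ (α - ρ α)) * jE hW)) (Valued.v ϖ ^ (2 * d - 1)) Rd hRd2 hRd3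
    (fun V => (Valued.v (κ₀ + jE V * ξ₀) * Valued.v (jE ϖ ^ j * (α - ρ α)) = Valued.v (jE ϖ) ^ b ∧ ∃ e : M, ρ e = e ∧ e * Θ e = (κ₀ + jE V * ξ₀) * ρ (κ₀ + jE V * ξ₀) / (h * ρ h))) (fun V => (Valued.v (γ₁ * (V - W₁)) = 1)) (fun V => (Valued.v (γ₁ * (V - W₁)) = 1 → normSign σ (γ₁ * (V - W₁)) = normSign σ (-hW))) ?_ ?_ ?_ ?_ ?_ ?_ ?_ _ _ ?_ ?_ ?_
  · -- hI: ★ p864148 §6 generator independence at radius `|jEϖ|^b ≤ |ϖ|^{2d−1}` (RAY: `2d − 1 ≤ b`) — datum-free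
    intro Λ x₀ x₀' hG hG'
    exact cls_iff_cls_and_v_sub_le_of_gen _hD jE _hjv _hjfix _hΘj _hρρ _hvρ _hΘΘ _hΘρ _hvΘ _hα _hα1 _hint _hΘh hb1 hdb hbj.le hcc hFgap hdeep2 κ₀ hξ0 hR
      (Valued.v ϖ ^ (2 * d - 1)) (by rw [hPn, hPnE, exp_le_exp]; omega) Λ x₀ x₀' ⟨hG.1, hG.2.1, hG.2.2.1, hG.2.2.2.1, hG.2.2.2.2.1⟩
      ⟨hG'.1, hG'.2.1, hG'.2.2.1, hG'.2.2.2.1, hG'.2.2.2.2.1⟩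
  · -- hV: the digit of a member (★ R1b-A §1)
    intro Λ x₀ hG
    obtain ⟨w₀, V, -, hσV, hV1, hjV, -⟩ := exists_vertexFrame_of_gen (α := α) _hD jE _hjiso _hjfix _hΘj _hρρ _hvρ _hΘΘ _hΘρ _hvΘ _hΘh _hh _hH₂σ φ _hφo _hform
      hb1 hcc hFgap hκ₀ hΘκ₀ hξ hΘξ hξ0 hκ₀v hR Λ x₀ ⟨hG.1, hG.2.1, hG.2.2.1, hG.2.2.2.1, hG.2.2.2.2.1⟩
    exact ⟨V, hjV, hσV, hV1⟩
  · -- hLit: a digit near a member is a literal digit (★ p863983)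
    intro Λ x₀ V₀ hG hV₀R hnear
    obtain ⟨hx₀, hΛx, hyO, hyp, hylev, -⟩ := hG
    exact lit_of_near_of_gen _hD jE _hjv _hjfix _hΘj _hρρ _hvρ _hΘΘ _hΘρ _hΘh _hh hb1 hcc hFgap hκ₀ hΘκ₀ hξ hΘξ hξ0 hrR hr₀ hdeep1 Λ x₀
      ⟨hx₀, hΛx, hyO, hyp, hylev⟩ V₀ (hRd1 V₀ hV₀R).1 hnear
  · -- hNX: the sphere is constant on `r`-balls (★ W1)
    intro Ve V₀ _ _ _ hnear
    exact sphere_iff_of_near (hball Ve V₀ hnear).2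
  · -- hψ: the sign implication is constant on `r`-balls (★ W1)
    intro Ve V₀ hσVe _ hV₀R hnear
    exact psi_iff_of_near _hD hσγ hσW₁ hσVe (hRd1 V₀ hV₀R).1 (hball Ve V₀ hnear).1 _
  · -- hF: LANE A — the fibre count over literal digits on type U (this seat's ★ p865033: every Θ-fixed unit is a Θ-norm, the flip is unconditional), after GEN6-fibre = GEN5-fibre
    intro y hy y' hy'
    rw [hfib y, hfib y']
    exact fibre_ncard_eq_of_lit_of_gen_typeU _hD jE _hjiso _hjfix _hΘj _hρρ _hvρ _hΘΘ _hΘρ _hΘh _hh hb1 hcc hFgap (_hfinLS j b) _hvΘ _hα1 _hU _hτ hκ₀ hΘκ₀ hξ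
      hΘξ hξ0 hrR hr₀ hdeep1 (∃ e : M, ρ e = e ∧ e * Θ e = -(h * ρ h * ((α - ρ α) * Θ (α - ρ α)) * jE hW)) Rd (fun V hV => (hRd1 V hV).1) _ (fun V _ hV => hV) y hy y' hy'
  · -- hbase: ★ F1 digit balance on the sphere at `n = ρ = 2d − 1`, with `C = LIT⋆` (constant under the sphere's twists by ★ p864666)
    have hC : ∀ V V' : E, σ V = V → Valued.v V ≤ 1 → σ V' = V' → Valued.v V' ≤ 1 → Valued.v (γ₁ * (V - W₁)) = 1 →
        Valued.v (γ₁ * (V' - V)) ≤ exp (-(2 * ((d - 1 : ℕ) : ℤ))) → ((Valued.v (κ₀ + jE V * ξ₀) * Valued.v (jE ϖ ^ j * (α - ρ α)) = Valued.v (jE ϖ) ^ b ∧ ∃ e : M, ρ e = e ∧ e * Θ e = (κ₀ + jE V * ξ₀) * ρ (κ₀ + jE V * ξ₀) / (h * ρ h)) ↔ (Valued.v (κ₀ + jE V' * ξ₀) * Valued.v (jE ϖ ^ j * (α - ρ α)) = Valued.v (jE ϖ) ^ b ∧ ∃ e : M, ρ e = e ∧ e * Θ e = (κ₀ + jE V'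 * ξ₀) * ρ (κ₀ + jE V' * ξ₀) / (h * ρ h))) := by
      intro V V' hσV _ hσV' _ _ hpert
      have h22 : exp (-(2 * ((d - 1 : ℕ) : ℤ))) = Valued.v ϖ ^ (2 * d - 2) := by rw [hPnE]; congr 1; omega
      rw [h22, Valuation.map_mul, hγ1, one_mul] at hpert
      exact litStar_iff_of_near_of_big jE _hjiso _hjfix _hΘj _hρρ _hvρ _hΘρ hκ₀ hΘκ₀ hξ hΘξ hξ0 hRe hjϖ0 hdeep1 hbig h2M hd2 hϖlt hσV hσV' hpert
    have hγn : Valued.v γ₁ * Valued.v ϖ ^ (2 * d - 1) = Valued.v ϖ ^ (2 * d - 1) := by rw [hγ1, one_mul]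
    have hF1 := card_filter_sphere_plus_eq_card_filter_not _hD h2v hσγ hγ1.ge hσW₁ hW₁1 (n := 2 * d - 1) (ρ := 2 * d - 1) hγn le_rfl Rd hRd1 hRd2 hRd3
      (fun V => (Valued.v (κ₀ + jE V * ξ₀) * Valued.v (jE ϖ ^ j * (α - ρ α)) = Valued.v (jE ϖ) ^ b ∧ ∃ e : M, ρ e = e ∧ e * Θ e = (κ₀ + jE V * ξ₀) * ρ (κ₀ + jE V * ξ₀) / (h * ρ h))) hC (s₀ := normSign σ (-hW)) (normSign_eq_one_or σ (-hW))
    beta_reduce at hF1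
    have hS : Rd.filter (fun V => (Valued.v (γ₁ * (V - W₁)) = 1) ∧ (Valued.v (κ₀ + jE V * ξ₀) * Valued.v (jE ϖ ^ j * (α - ρ α)) = Valued.v (jE ϖ) ^ b ∧ ∃ e : M, ρ e = e ∧ e * Θ e = (κ₀ + jE V * ξ₀) * ρ (κ₀ + jE V * ξ₀) / (h * ρ h))) = (Rd.filter (fun V => (Valued.v (κ₀ + jE V * ξ₀) * Valued.v (jE ϖ ^ j * (α - ρ α)) = Valued.v (jE ϖ) ^ b ∧ ∃ e : M, ρ e = e ∧ e * Θ e = (κ₀ + jE V * ξ₀) * ρ (κ₀ + jE V * ξ₀) / (h * ρ h)))).filter (fun V => (Valued.v (γ₁ * (V - W₁)) = 1)) := by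
      ext V
      simp only [Finset.mem_filter]
      exact ⟨fun hV => ⟨⟨hV.1, hV.2.2⟩, hV.2.1⟩, fun hV => ⟨hV.1.1, hV.2, hV.1.2⟩⟩
    rw [hS] at hF1
    have e1 : ((Rd.filter (fun V => (Valued.v (κ₀ + jE V * ξ₀) * Valued.v (jE ϖ ^ j * (α - ρ α)) = Valued.v (jE ϖ) ^ b ∧ ∃ e : M, ρ e = e ∧ e * Θ e = (κ₀ + jE V * ξ₀) * ρ (κ₀ + jE V * ξ₀) / (h * ρ h)))).filter (fun V => (Valued.v (γ₁ * (V - W₁)) = 1))).filter (fun V => (Valued.v (γ₁ * (V - W₁)) = 1 → normSign σ (γ₁ * (V - W₁)) = normSign σ (-hW))) =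
        ((Rd.filter (fun V => (Valued.v (κ₀ + jE V * ξ₀) * Valued.v (jE ϖ ^ j * (α - ρ α)) = Valued.v (jE ϖ) ^ b ∧ ∃ e : M, ρ e = e ∧ e * Θ e = (κ₀ + jE V * ξ₀) * ρ (κ₀ + jE V * ξ₀) / (h * ρ h)))).filter (fun V => (Valued.v (γ₁ * (V - W₁)) = 1))).filter (fun V => normSign σ (γ₁ * (V - W₁)) = normSign σ (-hW)) :=
      Finset.filter_congr fun V hV => by
        have hNv : (Valued.v (γ₁ * (V - W₁)) = 1) := (Finset.mem_filter.1 hV).2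
        exact ⟨fun hψ => hψ hNv, fun hs _ => hs⟩
    have e2 : ((Rd.filter (fun V => (Valued.v (κ₀ + jE V * ξ₀) * Valued.v (jE ϖ ^ j * (α - ρ α)) = Valued.v (jE ϖ) ^ b ∧ ∃ e : M, ρ e = e ∧ e * Θ e = (κ₀ + jE V * ξ₀) * ρ (κ₀ + jE V * ξ₀) / (h * ρ h)))).filter (fun V => (Valued.v (γ₁ * (V - W₁)) = 1))).filter (fun V => ¬ (Valued.v (γ₁ * (V - W₁)) = 1 → normSign σ (γ₁ * (V - W₁)) = normSign σ (-hW))) =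
        ((Rd.filter (fun V => (Valued.v (κ₀ + jE V * ξ₀) * Valued.v (jE ϖ ^ j * (α - ρ α)) = Valued.v (jE ϖ) ^ b ∧ ∃ e : M, ρ e = e ∧ e * Θ e = (κ₀ + jE V * ξ₀) * ρ (κ₀ + jE V * ξ₀) / (h * ρ h)))).filter (fun V => (Valued.v (γ₁ * (V - W₁)) = 1))).filter (fun V => ¬ normSign σ (γ₁ * (V - W₁)) = normSign σ (-hW)) :=
      Finset.filter_congr fun V hV => by
        have hNv : (Valued.v (γ₁ * (V - W₁)) = 1) := (Finset.mem_filter.1 hV).2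
        exact not_congr ⟨fun hψ => hψ hNv, fun hs _ => hs⟩
    rw [e1, e2]; exact hF1
  · -- hP: the population read (★ R1b-A §3)
    intro Λ x₀ hG
    exact weight_ne_zero_iff_cls_of_gen6 _hD h2v jE _hjv _hjfix _hΘj _hρρ _hvρ _hΘΘ _hΘρ _hvΘ _hΘh _hh hb1 hdb hcc hFgap _hhWσ hhW1 hlamj f _hf Λ x₀ hG
  · -- hL₁: the first literal read (R2b-B)
    intro Λ x₀ hG hfne
    exact (reads_of_gen6_lowerLine_ray _hD h2v jE _hjiso _hjfix _hΘj _hjpow _hϖmax _hρρ _hvρ _hα _hα1 _hint _hΘΘ _hΘρ _hvΘ _hΘh _hh _hH₂ _hH₂σ _hhW _hhWσ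
      φ _hφs _hφi _hφo _hφγ _hvlam _hΘlam _hform u huu hb1 hdb hbj hcc hlamj f _hf hFgap hκ₀ hΘκ₀ hξ hΘξ hξ0 hκ₀v hR hWc hBE hP0 hσP rfl hσγ hσW₁ hθ hWW hγb
      hμle hanti g1 g2 g3 hnmc gsk hlamn hun hμρ Λ x₀ hG hfne).1
  · -- hL₂: the second literal read (R2b-B)
    intro Λ x₀ hG hfne
    exact (reads_of_gen6_lowerLine_ray _hD h2v jE _hjiso _hjfix _hΘj _hjpow _hϖmax _hρρ _hvρ _hα _hα1 _hint _hΘΘ _hΘρ _hvΘ _hΘh _hh _hH₂ _hH₂σ _hhW _hhWσ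
      φ _hφs _hφi _hφo _hφγ _hvlam _hΘlam _hform u huu hb1 hdb hbj hcc hlamj f _hf hFgap hκ₀ hΘκ₀ hξ hΘξ hξ0 hκ₀v hR hWc hBE hP0 hσP rfl hσγ hσW₁ hθ hWW hγb
      hμle hanti g1 g2 g3 hnmc gsk hlamn hun hμρ Λ x₀ hG hfne).2

end Summit.HodgeConjecture.HodgeConjecture.Cruxes.H413.F0P3cDyRamBeta2ConesOffRowALowerRayWorkerHyper

end
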